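/-
Origin: expansion seat `planner-pub-hodgecm-pv06-g2-0`, handover 2026-08-18T04:57:56Z (`HOME/pub-hodgecm-pv06-g2/lean/Pv06g2/QuotientSmoothing.lean`, md5 987e4a2f, 430 lines);
landed by the gen-6 packager in gate run 22 as `HodgeCM/PerL34/QuotientSmoothing.lean` (verbatim).
-/
/-
Origin: HOME/pub-hodgecm-pv06-g2/lean/Pv06g2/QuotientSmoothing.lean — session planner-pub-hodgecm-pv06-g2-0 (unit
pub-hodgecm-pv06-g2, DAG-NODE PROVER #06 of 15, generation 2).  Intended final place:
`HodgeCM/PerL34/QuotientSmoothing.lean` (namespace `HodgeCM.PerL34.QuotientSmoothing`; rename the module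
`Pv06g2.QuotientSmoothing` ↦ `HodgeCM.PerL34.QuotientSmoothing`).
Imports: Mathlib + `HodgeCM.PerL34.KernelOperator` (pv05, run 19) + `HodgeCM.PerL34.ApproxIdentity` (pv06, run 21).
Every declaration below is closed (no placeholders, no new constants, nothing cited).

# The smoothing operators `R(f)` on `L²(G ⧸ Γ)` have continuous kernels — the `[SETUP D7]` field `sm_cont`

This file discharges, over the MATHLIB MODEL of the homogeneous space of N23c (a locally compact group `G`, a
discrete closed cocompact subgroup `Γ`, the quotient `X = G ⧸ Γ` with a finite `G`-invariant Borel measure `ν`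
obtained by folding a Haar measure `μ` over a fundamental domain `𝓕`), the last `[SETUP]` field of
`HodgeCM.PerL34.Annihilation.AnnihilationDatum` that is NOT a definitional packaging, namely

  `sm_cont : ∀ n v, ∃ x : Cf, j x = sm n v`     ("`R(f_n) v` is (represented by) a continuous function"),

for the concrete smoothing operators `sm n = ApproxIdentity.smOp μ ρ … (f n) …` of `HodgeCM.PerL34.ApproxIdentity`
(`R(f) v = ∫_G f(g) • ρ(g) v dμ(g)`, `ρ` = the regular representation of `G` on `L²(X, ν)`), with `j = toLp` the
inclusion `C(X, ℂ) → L²(X, ν)`.  The mechanism is the classical one (Gelfand–Graev–Piatetski-Shapiro, ch. 1 §2;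
the tex source ll. 378–382: "`R(f)` is an integral operator with the continuous kernel
`K_f(x, y) = ∑_{γ ∈ Γ} f(x γ y⁻¹)`"):

* §1  for `f ∈ C_c(G)` the lattice sum `k̃_f(a, b) = ∑_{γ ∈ Γ} f(a γ b⁻¹)` is locally finite, hence continuous on
      `G × G` (`continuous_foldG`), and it is `Γ`-invariant in both variables, so it descends to a continuous kernel
      `foldK f ∈ C(X × X, ℂ)` (`foldK`, `foldK_mk`);
* §2  the UNFOLDING identity (`integral_mul_act_eq`): for `y ∈ C(X, ℂ)` and `a ∈ G`,
      `∫_G f(g) y(g⁻¹ • π a) dμ(g) = ∫_X foldK f (π a, q) y(q) dν(q)` — from Mathlib's unfolding trick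
      `QuotientGroup.integral_mul_eq_integral_automorphize_mul` plus the substitutions `g ↦ a⁻¹ g ↦ g⁻¹`
      (left-invariance and inversion-invariance of the unimodular Haar measure `μ`);
* §3  the regular representation `ρ` (`ρ`, `ρ_mul`, `continuous_ρ_apply`, `opNorm_ρ_le_one`), and the operator
      identity `R(f) = 𝒯_{foldK f}` (`smOp_eq_opT`) with pv05's bounded kernel operator
      `KernelOperator.opT : L²(ν) → L²(ν)`, whose values are `toLp` of continuous functions BY CONSTRUCTION
      (`KernelOperator.opT_eq_toLp`); the two bounded operators agree on the dense subspace `toLp (C(X, ℂ))`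
      (`ContinuousMap.toLp_denseRange`) by §2, hence everywhere.  Conclusion: `exists_toLp_eq_smOp` and the
      literal `sm_cont`-shaped statement `sm_cont_model`.

Hypotheses are the standard standing ones of the model and are all instances/statements of Mathlib:
`μ` left- and right-invariant and inversion-invariant (unimodularity; needed for the substitution in §2),
finite on compacts; `Γ` countable, discrete and closed; `X = G ⧸ Γ` compact Hausdorff with its Borel σ-algebra;
`ν` finite, `G`-invariant and inner regular (`ν.InnerRegularCompactLTTop`, which makes `g ↦ ρ(g) v` continuous and
`C(X)` dense in `L²`); the unfolding identity and everything downstream of it take the folding hypothesis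
`hν : ν = map π (μ.restrict 𝓕)` for a fundamental domain `𝓕` of the right `Γ`-action (`IsFundamentalDomain Γ.op 𝓕 μ`),
exactly as in Mathlib's `MeasureTheory.Measure.Haar.Quotient`.

What this does NOT do (residual, class SETUP/DICT, not analysis): identify the adelic double-coset space `[U(W)]`
of N23c with such a `G ⧸ Γ` (dictionary item D3 of LEMMAS.md §9) — that is the definition of the objects of N23,
not a claim about them.
-/
import Mathlib
import Summits.HodgeConjecture.HodgeCM.PerL34.KernelOperator
import Summits.HodgeConjecture.HodgeCM.PerL34.ApproxIdentity

set_option autoImplicit false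

noncomputable section

open MeasureTheory Topology Filter Function
open scoped ENNReal Pointwise

attribute [-instance] Quotient.instMeasurableSpace

namespace HodgeCM
namespace PerL34
namespace QuotientSmoothing

/-! ## §1  The lattice sum `k̃_f(a, b) = ∑_{γ ∈ Γ} f(a γ b⁻¹)` and its descent to `X × X` -/
section Fold

variable {G : Type*} [Group G] {Γ : Subgroup G}

variable (Γ) in
/-- The summand family `γ ↦ ((a, b) ↦ f(a γ b⁻¹))` (complex values). -/
def foldTerm (f : G → ℝ) (γ : Γ) (p : G × G) : ℂ := (f (p.1 * γ * p.2⁻¹) : ℂ)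

variable (Γ) in
/-- (Ported verbatim from the HodgeCMPerL package; no docstring in the source.) -/
@[simp] theorem foldTerm_apply (f : G → ℝ) (γ : Γ) (p : G × G) :
    foldTerm Γ f γ p = (f (p.1 * γ * p.2⁻¹) : ℂ) := rfl

variable (Γ) in
/-- `k̃_f(a, b) = ∑_{γ ∈ Γ} f(a γ b⁻¹)` on `G × G` (a finite sum at each point, see `foldTerm_locallyFinite`). -/
def foldG (f : G → ℝ) (p : G × G) : ℂ := ∑ᶠ γ : Γ, foldTerm Γ f γ p

variable (Γ) in
/-- (Ported verbatim from the HodgeCMPerL package; no docstring in the source.) -/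
theorem foldG_apply (f : G → ℝ) (a b : G) : foldG Γ f (a, b) = ∑ᶠ γ : Γ, (f (a * γ * b⁻¹) : ℂ) := rfl

variable (Γ) in
/-- `Γ`-invariance in the first variable. -/
theorem foldG_mul_left (f : G → ℝ) (a b : G) (δ : Γ) : foldG Γ f (a * δ, b) = foldG Γ f (a, b) := by
  unfold foldG
  refine finsum_eq_of_bijective (fun γ => δ * γ) (Equiv.mulLeft δ).bijective fun γ => ?_
  simp only [foldTerm_apply, Subgroup.coe_mul, mul_assoc]

variable (Γ) in
/-- `Γ`-invariance in the second variable. -/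
theorem foldG_mul_right (f : G → ℝ) (a b : G) (δ : Γ) : foldG Γ f (a, b * δ) = foldG Γ f (a, b) := by
  unfold foldG
  refine finsum_eq_of_bijective (fun γ => γ * δ⁻¹) (Equiv.mulRight δ⁻¹).bijective fun γ => ?_
  simp only [foldTerm_apply, Subgroup.coe_mul, Subgroup.coe_inv, mul_inv_rev, mul_assoc]

variable (Γ) in
/-- The descended kernel on `X × X`, `X = G ⧸ Γ`, as a bare function (via representatives). -/
def foldQ (f : G → ℝ) (p : (G ⧸ Γ) × (G ⧸ Γ)) : ℂ := foldG Γ f (p.1.out, p.2.out)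

variable (Γ) in
/-- (Ported verbatim from the HodgeCMPerL package; no docstring in the source.) -/
theorem foldQ_mk (f : G → ℝ) (a b : G) : foldQ Γ f ((a : G ⧸ Γ), (b : G ⧸ Γ)) = foldG Γ f (a, b) := by
  obtain ⟨δ, hδ⟩ := QuotientGroup.mk_out_eq_mul Γ a
  obtain ⟨ε, hε⟩ := QuotientGroup.mk_out_eq_mul Γ b
  unfold foldQ
  rw [hδ, hε, foldG_mul_left, foldG_mul_right]

/-- Unfolding `QuotientGroup.automorphize` at a class. -/
theorem automorphize_mk (F : G → ℂ) (b : G) :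
    QuotientGroup.automorphize F (b : G ⧸ Γ) = ∑' γ : Γ.op, F (γ • b) := rfl

variable [TopologicalSpace G]

/-- A closed discrete subgroup meets every compact set in a finite set. -/
theorem finite_coe_mem_of_isCompact [DiscreteTopology Γ] (hΓ : IsClosed (Γ : Set G)) {C : Set G}
    (hC : IsCompact C) : {γ : Γ | (γ : G) ∈ C}.Finite :=
  (hΓ.isClosedEmbedding_subtypeVal.isCompact_preimage hC).finite_of_discrete

variable [IsTopologicalGroup G]

/-- Local finiteness of the lattice sum: near any `(a, b)` only the finitely many `γ ∈ Γ ∩ A⁻¹ (supp f) B`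
(`A`, `B` compact neighbourhoods) contribute. -/
theorem foldTerm_locallyFinite [LocallyCompactSpace G] [DiscreteTopology Γ] (hΓ : IsClosed (Γ : Set G))
    (f : G → ℝ) (hfs : HasCompactSupport f) :
    LocallyFinite fun γ : Γ => support (foldTerm Γ f γ) := by
  intro p
  obtain ⟨A, hA, hAp⟩ := exists_compact_mem_nhds p.1
  obtain ⟨B, hB, hBp⟩ := exists_compact_mem_nhds p.2
  refine ⟨A ×ˢ B, prod_mem_nhds hAp hBp, ?_⟩
  refine (finite_coe_mem_of_isCompact hΓ ((hA.inv.mul hfs.isCompact).mul hB)).subset ?_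
  rintro γ ⟨q, hq, hqA, hqB⟩
  have hs : q.1 * γ * q.2⁻¹ ∈ tsupport f := by
    apply subset_tsupport
    rw [mem_support] at hq ⊢
    simpa [foldTerm] using hq
  refine ⟨q.1⁻¹ * (q.1 * γ * q.2⁻¹), Set.mul_mem_mul (Set.inv_mem_inv.mpr (by simpa using hqA)) hs, q.2, hqB, ?_⟩
  group

/-- At each point the lattice sum has finitely many non-zero terms. -/
theorem finite_support_foldTerm [LocallyCompactSpace G] [DiscreteTopology Γ] (hΓ : IsClosed (Γ : Set G))
    (f : G → ℝ) (hfs : HasCompactSupport f) (p : G × G) :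
    (support fun γ : Γ => foldTerm Γ f γ p).Finite :=
  (foldTerm_locallyFinite hΓ f hfs).point_finite p

/-- `k̃_f` is continuous on `G × G`. -/
theorem continuous_foldG [LocallyCompactSpace G] [DiscreteTopology Γ] (hΓ : IsClosed (Γ : Set G))
    (f : G → ℝ) (hf : Continuous f) (hfs : HasCompactSupport f) : Continuous (foldG Γ f) := by
  change Continuous fun p => ∑ᶠ γ : Γ, foldTerm Γ f γ p
  refine continuous_finsum (fun γ => ?_) (foldTerm_locallyFinite hΓ f hfs)
  change Continuous fun p : G × G => ((f (p.1 * γ * p.2⁻¹) : ℝ) : ℂ)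
  exact Complex.continuous_ofReal.comp (hf.comp (by fun_prop))

/-- (Ported verbatim from the HodgeCMPerL package; no docstring in the source.) -/
theorem continuous_foldQ [LocallyCompactSpace G] [DiscreteTopology Γ] (hΓ : IsClosed (Γ : Set G))
    (f : G → ℝ) (hf : Continuous f) (hfs : HasCompactSupport f) : Continuous (foldQ Γ f) := by
  have h : foldQ Γ f ∘ Prod.map (QuotientGroup.mk : G → G ⧸ Γ) (QuotientGroup.mk : G → G ⧸ Γ) = foldG Γ f := by
    funext p
    exact foldQ_mk Γ f p.1 p.2
  rw [← (QuotientGroup.isOpenQuotientMap_mk.prodMap QuotientGroup.isOpenQuotientMap_mk).continuous_comp_iff, h]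
  exact continuous_foldG hΓ f hf hfs

/-- **The continuous kernel `K_f ∈ C(X × X, ℂ)`, `K_f(π a, π b) = ∑_{γ ∈ Γ} f(a γ b⁻¹)`** (tex l. 379). -/
def foldK [LocallyCompactSpace G] [DiscreteTopology Γ] (hΓ : IsClosed (Γ : Set G))
    (f : G → ℝ) (hf : Continuous f) (hfs : HasCompactSupport f) : C((G ⧸ Γ) × (G ⧸ Γ), ℂ) :=
  ⟨foldQ Γ f, continuous_foldQ hΓ f hf hfs⟩

/-- (Ported verbatim from the HodgeCMPerL package; no docstring in the source.) -/
theorem foldK_mk [LocallyCompactSpace G] [DiscreteTopology Γ] (hΓ : IsClosed (Γ : Set G))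
    (f : G → ℝ) (hf : Continuous f) (hfs : HasCompactSupport f) (a b : G) :
    foldK hΓ f hf hfs ((a : G ⧸ Γ), (b : G ⧸ Γ)) = ∑ᶠ γ : Γ, (f (a * γ * b⁻¹) : ℂ) :=
  foldQ_mk Γ f a b

end Fold

/-! ## §2  The unfolding identity -/
section Unfold

variable {G : Type*} [Group G] [TopologicalSpace G] [IsTopologicalGroup G] [LocallyCompactSpace G]
  [MeasurableSpace G] [BorelSpace G] {Γ : Subgroup G} [DiscreteTopology Γ] [Countable Γ]
  (hΓ : IsClosed (Γ : Set G)) [MeasurableSpace (G ⧸ Γ)] [BorelSpace (G ⧸ Γ)] [CompactSpace (G ⧸ Γ)]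
  (μ : Measure G) [IsFiniteMeasureOnCompacts μ] [μ.IsMulLeftInvariant] [μ.IsMulRightInvariant]
  [μ.IsInvInvariant]
  (f : G → ℝ) (hf : Continuous f) (hfs : HasCompactSupport f)

omit [MeasurableSpace G] [BorelSpace G] [Countable Γ] [MeasurableSpace (G ⧸ Γ)] [BorelSpace (G ⧸ Γ)]
  [CompactSpace (G ⧸ Γ)] in
/-- The folded function of `h ↦ f(a h⁻¹)` is the kernel section `K_f(π a, ·)`. -/
theorem automorphize_eq_foldK (a : G) :
    QuotientGroup.automorphize (fun h : G => (f (a * h⁻¹) : ℂ)) =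
      fun q : G ⧸ Γ => foldK hΓ f hf hfs ((a : G ⧸ Γ), q) := by
  funext q
  induction q using QuotientGroup.induction_on with
  | H b =>
    rw [automorphize_mk, foldK_mk]
    -- the reindexing `Γ.op → Γ`, `γ ↦ (γ.unop)⁻¹`
    set e : Γ.op → Γ := fun γ => ⟨(MulOpposite.unop (γ : Gᵐᵒᵖ))⁻¹, Γ.inv_mem (Subgroup.mem_op.mp γ.2)⟩ with he
    have he_bij : Bijective e := by
      refine Function.bijective_iff_has_inverse.mpr ⟨fun δ => ⟨MulOpposite.op ((δ : G)⁻¹), ?_⟩, ?_, ?_⟩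
      · exact Subgroup.mem_op.mpr (by simp)
      · intro γ; simp [he]
      · intro δ; simp [he]
    have hterm : ∀ γ : Γ.op, (fun γ : Γ.op => (f (a * (γ • b)⁻¹) : ℂ)) γ = (f (a * (e γ : G) * b⁻¹) : ℂ) := by
      intro γ
      simp only [he, Subgroup.smul_def, MulOpposite.smul_eq_mul_unop, mul_inv_rev, mul_assoc]
    have hfinΓ : (support fun δ : Γ => (f (a * δ * b⁻¹) : ℂ)).Finite :=
      finite_support_foldTerm hΓ f hfs (a, b)
    have hfin : (support fun γ : Γ.op => (f (a * (γ • b)⁻¹) : ℂ)).Finite := by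
      have hsub : (support fun γ : Γ.op => (f (a * (γ • b)⁻¹) : ℂ)) = e ⁻¹' (support fun δ : Γ => (f (a * δ * b⁻¹) : ℂ)) := by
        ext γ
        rw [Set.mem_preimage, mem_support, mem_support, ← hterm γ]
      rw [hsub]
      exact hfinΓ.preimage he_bij.injective.injOn
    rw [tsum_eq_finsum hfin]
    exact finsum_eq_of_bijective e he_bij hterm

/-- **Unfolding** (tex ll. 378–380): for `y ∈ C(X, ℂ)` and `a ∈ G`,
`∫_G f(g) y(g⁻¹ • π a) dμ(g) = ∫_X K_f(π a, q) y(q) dν(q)` with `ν = map π (μ|_𝓕)`. -/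
theorem integral_mul_act_eq {𝓕 : Set G} (h𝓕 : IsFundamentalDomain Γ.op 𝓕 μ)
    (y : C(G ⧸ Γ, ℂ)) (a : G) :
    ∫ g, (f g : ℂ) * y (g⁻¹ • (a : G ⧸ Γ)) ∂μ =
      ∫ q, foldK hΓ f hf hfs ((a : G ⧸ Γ), q) * y q
        ∂(Measure.map (QuotientGroup.mk : G → G ⧸ Γ) (μ.restrict 𝓕)) := by
  -- the auxiliary functions
  set Fa : G → ℂ := fun h => (f (a * h⁻¹) : ℂ) with hFa
  set θ : G → ℂ := fun h => y (h : G ⧸ Γ) * Fa h with hθ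
  have hFa_cont : Continuous Fa := Complex.continuous_ofReal.comp (hf.comp (by fun_prop))
  have hFa_supp : HasCompactSupport Fa := by
    have h1 : HasCompactSupport (f ∘ ((Homeomorph.inv G).trans (Homeomorph.mulLeft a))) :=
      hfs.comp_homeomorph _
    have h2 := h1.comp_left Complex.ofReal_zero
    exact h2
  have hFa_int : Integrable Fa μ := hFa_cont.integrable_of_hasCompactSupport hFa_supp
  -- step 1: substitutions `g ↦ a⁻¹ g`, `g ↦ g⁻¹`
  have hΦ : (fun g : G => (f g : ℂ) * y (g⁻¹ • (a : G ⧸ Γ))) = fun g => (fun t : G => θ t⁻¹) (a⁻¹ * g) := by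
    funext g
    simp only [hθ, hFa, MulAction.Quotient.smul_coe, smul_eq_mul, mul_inv_rev, inv_inv, mul_inv_cancel_left]
    rw [mul_comm]
  have step1 : ∫ g, (f g : ℂ) * y (g⁻¹ • (a : G ⧸ Γ)) ∂μ = ∫ h, θ h ∂μ := by
    rw [hΦ, integral_mul_left_eq_self (fun t : G => θ t⁻¹) a⁻¹]
    exact integral_inv_eq_self θ μ
  -- step 2: Mathlib's unfolding trick
  have hy_meas : AEStronglyMeasurable (fun q : G ⧸ Γ => y q)
      (Measure.map (QuotientGroup.mk : G → G ⧸ Γ) (μ.restrict 𝓕)) :=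
    y.continuous.aestronglyMeasurable
  have hy_bdd : essSup (fun q : G ⧸ Γ => (‖y q‖ₑ : ℝ≥0∞))
      (Measure.map (QuotientGroup.mk : G → G ⧸ Γ) (μ.restrict 𝓕)) ≠ ∞ := by
    refine (lt_of_le_of_lt (essSup_le_of_ae_le ‖y‖ₑ (ae_of_all _ fun q => ?_)) enorm_lt_top).ne
    change ‖y q‖ₑ ≤ ‖y‖ₑ
    rw [← ofReal_norm, ← ofReal_norm]
    exact ENNReal.ofReal_le_ofReal (y.norm_coe_le_norm q)
  have hauto : AEStronglyMeasurable (QuotientGroup.automorphize Fa)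
      (Measure.map (QuotientGroup.mk : G → G ⧸ Γ) (μ.restrict 𝓕)) := by
    rw [hFa, automorphize_eq_foldK hΓ f hf hfs a]
    exact ((foldK hΓ f hf hfs).continuous.comp (Continuous.prodMk_right _)).aestronglyMeasurable
  have step2 := QuotientGroup.integral_mul_eq_integral_automorphize_mul h𝓕 hFa_int hy_meas hy_bdd hauto
  -- assemble
  rw [step1, hθ]
  rw [step2, hFa, automorphize_eq_foldK hΓ f hf hfs a]
  refine integral_congr_ae (ae_of_all _ fun q => ?_)
  simp only [mul_comm]

end Unfold

/-! ## §3  The regular representation on `L²(X)` and the operator identity `R(f) = 𝒯_{K_f}` -/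
section Regular

variable {G : Type*} [Group G] [TopologicalSpace G] [IsTopologicalGroup G] {Γ : Subgroup G}

/-- The action maps `x ↦ g⁻¹ • x` as a continuous family of continuous self-maps of `X = G ⧸ Γ`. -/
def act : C(G, C(G ⧸ Γ, G ⧸ Γ)) :=
  (ContinuousMap.mk (fun p : G × (G ⧸ Γ) => p.1⁻¹ • p.2) (by fun_prop)).curry

/-- (Ported verbatim from the HodgeCMPerL package; no docstring in the source.) -/
@[simp] theorem act_apply (g : G) (x : G ⧸ Γ) : (act g : C(G ⧸ Γ, G ⧸ Γ)) x = g⁻¹ • x := rfl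

variable [MeasurableSpace (G ⧸ Γ)] [BorelSpace (G ⧸ Γ)] (ν : Measure (G ⧸ Γ)) [SMulInvariantMeasure G (G ⧸ Γ) ν]

/-- (Ported verbatim from the HodgeCMPerL package; no docstring in the source.) -/
theorem measurePreserving_act (g : G) : MeasurePreserving (act g : G ⧸ Γ → G ⧸ Γ) ν ν :=
  measurePreserving_smul g⁻¹ ν

/-- **The regular representation** `(ρ(g) v)(x) = v(g⁻¹ • x)` of `G` on `L²(X, ν)`, one operator at a time. -/
def ρ (g : G) : Lp ℂ 2 ν →L[ℂ] Lp ℂ 2 ν :=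
  (Lp.compMeasurePreservingₗᵢ ℂ (act g : G ⧸ Γ → G ⧸ Γ) (measurePreserving_act ν g)).toContinuousLinearMap

/-- (Ported verbatim from the HodgeCMPerL package; no docstring in the source.) -/
theorem ρ_apply (g : G) (v : Lp ℂ 2 ν) :
    ρ ν g v = Lp.compMeasurePreserving (act g : G ⧸ Γ → G ⧸ Γ) (measurePreserving_act ν g) v := rfl

/-- (Ported verbatim from the HodgeCMPerL package; no docstring in the source.) -/
theorem coeFn_ρ (g : G) (v : Lp ℂ 2 ν) : (ρ ν g v : G ⧸ Γ → ℂ) =ᵐ[ν] fun x => v (g⁻¹ • x) :=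
  Lp.coeFn_compMeasurePreserving v (measurePreserving_act ν g)

/-- (Ported verbatim from the HodgeCMPerL package; no docstring in the source.) -/
@[simp] theorem norm_ρ (g : G) (v : Lp ℂ 2 ν) : ‖ρ ν g v‖ = ‖v‖ :=
  Lp.norm_compMeasurePreserving v (measurePreserving_act ν g)

/-- (Ported verbatim from the HodgeCMPerL package; no docstring in the source.) -/
theorem ρ_mul (g h : G) (v : Lp ℂ 2 ν) : ρ ν (g * h) v = ρ ν g (ρ ν h v) := by
  rw [Lp.ext_iff]
  have h1 := coeFn_ρ ν (g * h) v
  have h2 := coeFn_ρ ν g (ρ ν h v)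
  have h3 : (fun x => (ρ ν h v : G ⧸ Γ → ℂ) (g⁻¹ • x)) =ᵐ[ν] fun x => v (h⁻¹ • (g⁻¹ • x)) :=
    (measurePreserving_act ν g).quasiMeasurePreserving.ae_eq_comp (coeFn_ρ ν h v)
  filter_upwards [h1, h2, h3] with x hx1 hx2 hx3
  rw [hx1, hx2, hx3, mul_inv_rev, mul_smul]

/-- (Ported verbatim from the HodgeCMPerL package; no docstring in the source.) -/
theorem ρ_one (v : Lp ℂ 2 ν) : ρ ν 1 v = v := by
  rw [Lp.ext_iff]
  filter_upwards [coeFn_ρ ν 1 v] with x hx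
  rw [hx, inv_one, one_smul]

/-- `ρ` as a monoid homomorphism `G →* (L²(X) →L[ℂ] L²(X))`. -/
def ρHom : G →* (Lp ℂ 2 ν →L[ℂ] Lp ℂ 2 ν) where
  toFun := ρ ν
  map_one' := ContinuousLinearMap.ext fun v => ρ_one ν v
  map_mul' g h := ContinuousLinearMap.ext fun v => ρ_mul ν g h v

/-- (Ported verbatim from the HodgeCMPerL package; no docstring in the source.) -/
@[simp] theorem ρHom_apply (g : G) : ρHom ν g = ρ ν g := rfl

/-- (Ported verbatim from the HodgeCMPerL package; no docstring in the source.) -/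
theorem opNorm_ρ_le_one (g : G) : ‖ρHom ν g‖ ≤ 1 :=
  ContinuousLinearMap.opNorm_le_bound _ zero_le_one fun v => by rw [one_mul, ρHom_apply, norm_ρ]

variable [T2Space (G ⧸ Γ)] [IsFiniteMeasure ν] [ν.InnerRegularCompactLTTop]

/-- Strong continuity of the regular representation: `g ↦ ρ(g) v` is continuous for every `v ∈ L²(X)`. -/
theorem continuous_ρ_apply (v : Lp ℂ 2 ν) : Continuous fun g : G => ρHom ν g v :=
  Continuous.compMeasurePreservingLp (μ := ν) (ν := ν) (E := ℂ) (p := 2) continuous_const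
    (act (Γ := Γ)).continuous (fun g => measurePreserving_act ν g) ENNReal.ofNat_ne_top

variable [CompactSpace (G ⧸ Γ)]

omit [T2Space (G ⧸ Γ)] [ν.InnerRegularCompactLTTop] in
/-- (Ported verbatim from the HodgeCMPerL package; no docstring in the source.) -/
theorem ρ_toLp (g : G) (y : C(G ⧸ Γ, ℂ)) :
    ρ ν g (ContinuousMap.toLp (E := ℂ) 2 ν ℂ y) = ContinuousMap.toLp (E := ℂ) 2 ν ℂ (y.comp (act g)) := by
  rw [Lp.ext_iff]
  have h1 := coeFn_ρ ν g (ContinuousMap.toLp (E := ℂ) 2 ν ℂ y)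
  have h2 : (fun x => (ContinuousMap.toLp (E := ℂ) 2 ν ℂ y : G ⧸ Γ → ℂ) (g⁻¹ • x)) =ᵐ[ν] fun x => y (g⁻¹ • x) :=
    (measurePreserving_act ν g).quasiMeasurePreserving.ae_eq_comp
      (ContinuousMap.coeFn_toLp (E := ℂ) (p := 2) (𝕜 := ℂ) ν y)
  filter_upwards [h1, h2, ContinuousMap.coeFn_toLp (E := ℂ) (p := 2) (𝕜 := ℂ) ν (y.comp (act g))]
    with x hx1 hx2 hx3
  rw [hx1, hx2, hx3]
  rfl

variable [MeasurableSpace G] [BorelSpace G] (μ : Measure G) [IsFiniteMeasureOnCompacts μ]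
  (f : G → ℝ) (hf : Continuous f) (hfs : HasCompactSupport f)

/-- The smoothing operator `R(f) = ∫ f(g) ρ(g) dμ(g)` of `ApproxIdentity` for the regular representation. -/
abbrev smOpX : Lp ℂ 2 ν →L[ℂ] Lp ℂ 2 ν :=
  ApproxIdentity.smOp μ (ρHom ν) (continuous_ρ_apply ν) 1 (opNorm_ρ_le_one ν) f hf hfs

omit [MeasurableSpace (G ⧸ Γ)] [BorelSpace (G ⧸ Γ)] [T2Space (G ⧸ Γ)] in
include hf hfs in
/-- (Ported verbatim from the HodgeCMPerL package; no docstring in the source.) -/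
theorem integrable_smul_comp_act (y : C(G ⧸ Γ, ℂ)) :
    Integrable (fun g : G => (f g : ℂ) • y.comp (act (Γ := Γ) g)) μ := by
  refine ((Complex.continuous_ofReal.comp hf).smul
    ((ContinuousMap.continuous_postcomp y).comp (act (Γ := Γ)).continuous)).integrable_of_hasCompactSupport ?_
  exact HasCompactSupport.intro' hfs.isCompact (isClosed_tsupport _) fun x hx => by
    simp [image_eq_zero_of_notMem_tsupport hx]

/-- On continuous functions, `R(f)` is `toLp` of a `C(X)`-valued Bochner integral. -/
theorem smOpX_toLp (y : C(G ⧸ Γ, ℂ)) :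
    smOpX ν μ f hf hfs (ContinuousMap.toLp (E := ℂ) 2 ν ℂ y) =
      ContinuousMap.toLp (E := ℂ) 2 ν ℂ (∫ g, (f g : ℂ) • y.comp (act g) ∂μ) := by
  rw [smOpX, ApproxIdentity.smOp_apply]
  rw [← (ContinuousMap.toLp (E := ℂ) 2 ν ℂ).integral_comp_comm (integrable_smul_comp_act μ f hf hfs y)]
  refine integral_congr_ae (ae_of_all _ fun g => ?_)
  simp only [ρHom_apply, ρ_toLp, map_smul]


-- port_pkg: scope closed for this part
end Regular
end QuotientSmoothing
end PerL34
end HodgeCM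
end
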